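import Literature.AlgebraicGeometry.Frobenioids.EquivalenceDegreesOfPreSteps
import HarnessLib

/-!
# Frobenioids I, §3: Theorem 3.4 (iii) from Theorem 3.4 (ii) — the preservation list and all Frobenius
# degrees, isotropic type (pre-step preservation as a HYPOTHESIS)

Mochizuki, *The geometry of Frobenioids I: the general theory*, Kyushu J. Math. **62** (2008),
Thm. 3.4 (iii), proof, kurims p. 64: "… `Ψ^istr` preserves morphisms of Frobenius type, hence also
linear morphisms [by Proposition 1.7, (iii)] … Moreover, by assertions (i), (ii), `Ψ` preserves isometric
pre-steps and pre-steps, hence base-isomorphisms [cf. Proposition 1.7, (ii)], pull-back morphisms [cf.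
Proposition 1.7, (ii)], isometries …, co-angular morphisms …, and LB-invertible morphisms"
[cite: MochizukiFrdI2008, Thm. 3.4 (iii) p.64].

PROOF-ONLY file (seat abc-iut-L1-t11; GAP-LEDGER row G-L1d8-1): seat abc-iut-L1-t13's
`EquivalenceLinearMorphisms.lean` and the isotropic part of `EquivalenceFrobeniusQuasiIsotropic.lean`
re-run with "`Ψ`, `Ψ⁻¹` preserve pre-steps" (hypotheses `hΨ`, `hΨ'` = the conclusion of Thm. 3.4 (ii))
in place of "bases of FSM-type". Standing hypotheses: `C₁`, `C₂` Frobenioids of isotropic type, `Φ₁`,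
`Φ₂` non-dilating, non-group-like objects on both sides, `Ψ : C₁ ⥲ C₂`. Then `Ψ` preserves linear
morphisms (Prop. 1.7 (iii)), base-isomorphisms and pull-back morphisms (Prop. 1.7 (ii)), isometries
(Def. 1.3 (iv)(a)), co-angular and LB-invertible morphisms, and the Frobenius degree of every morphism
(`FrdI.OfPreSteps.degFr_map_of_isotropic`). No statement of the paper is restated or strengthened.
-/

set_option backward.isDefEq.respectTransparency false

namespace Literature.AlgebraicGeometry.Frobenioids

open CategoryTheory Opposite

universe w v v' u u'

namespace FrdI

namespace OfPreSteps

section Two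

variable {D₁ : Type u} [Category.{v} D₁] {Φ₁ : D₁ᵒᵖ ⥤ CommMonCat.{w}} {C₁ : Type u'}
  [Category.{v'} C₁] {D₂ : Type u} [Category.{v} D₂] {Φ₂ : D₂ᵒᵖ ⥤ CommMonCat.{w}} {C₂ : Type u'}
  [Category.{v'} C₂] {F₁ : C₁ ⥤ ElemFrobenioid Φ₁} {F₂ : C₂ ⥤ ElemFrobenioid Φ₂}

/-- **Thm. 3.4 (iii): `Ψ` preserves linear morphisms** (Prop. 1.7 (iii) + Frobenius type preserved by
`Ψ⁻¹`). [cite: MochizukiFrdI2008, Thm. 3.4 (iii) p.64] -/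
theorem isLinear_map (hF₁ : PreFrobenioid.IsFrobenioid F₁) (hF₂ : PreFrobenioid.IsFrobenioid F₂)
    (hi₁ : ∀ A : C₁, PreFrobenioid.IsIsotropic F₁ A) (hi₂ : ∀ A : C₂, PreFrobenioid.IsIsotropic F₂ A)
    (hnd₁ : IsNonDilatingOn Φ₁) (Ψ : C₁ ≌ C₂)
    (hΨ : ∀ ⦃A B : C₁⦄ ⦃φ : A ⟶ B⦄, PreFrobenioid.IsPreStep F₁ φ →
      PreFrobenioid.IsPreStep F₂ (Ψ.functor.map φ))
    (hΨ' : ∀ ⦃A B : C₂⦄ ⦃φ : A ⟶ B⦄, PreFrobenioid.IsPreStep F₂ φ →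
      PreFrobenioid.IsPreStep F₁ (Ψ.inverse.map φ))
    {N₂ : C₂} (hN₂ : ¬ PreFrobenioid.IsGroupLikeObj F₂ N₂) {A B : C₁} {φ : A ⟶ B}
    (hφ : PreFrobenioid.IsLinear F₁ φ) : PreFrobenioid.IsLinear F₂ (Ψ.functor.map φ) := by
  rw [PreFrobenioid.isLinear_iff_isMinimalAdjoint F₂ hF₂]
  refine ((PreFrobenioid.isLinear_iff_isMinimalAdjoint F₁ hF₁ φ).1 hφ).map_equivalence Ψ
    (S₂ := fun _ _ f => PreFrobenioid.IsFrobeniusType F₂ f) (fun X Y β hβ => ?_) (fun X X' Y i β hi hβ => ?_)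
  · exact isFrobeniusType_map hF₂ hF₁ hi₂ hi₁ hnd₁ Ψ.symm hΨ' hΨ hN₂ _ hβ rfl
  · haveI := hi
    exact PreFrobenioid.IsFrobeniusType.comp F₁ hF₁ (PreFrobenioid.isFrobeniusType_of_isIso F₁ hF₁.isPreFrobenioid i) hβ

/-- **Thm. 3.4 (iii): `Ψ` preserves base-isomorphisms** (Prop. 1.7 (ii): a base-isomorphism is a
morphism of Frobenius type followed by a pre-step). [cite: MochizukiFrdI2008, Thm. 3.4 (iii) p.64] -/
theorem isBaseIso_map (hF₁ : PreFrobenioid.IsFrobenioid F₁) (hF₂ : PreFrobenioid.IsFrobenioid F₂)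
    (hi₁ : ∀ A : C₁, PreFrobenioid.IsIsotropic F₁ A) (hi₂ : ∀ A : C₂, PreFrobenioid.IsIsotropic F₂ A)
    (hnd₂ : IsNonDilatingOn Φ₂) (Ψ : C₁ ≌ C₂)
    (hΨ : ∀ ⦃A B : C₁⦄ ⦃φ : A ⟶ B⦄, PreFrobenioid.IsPreStep F₁ φ →
      PreFrobenioid.IsPreStep F₂ (Ψ.functor.map φ))
    (hΨ' : ∀ ⦃A B : C₂⦄ ⦃φ : A ⟶ B⦄, PreFrobenioid.IsPreStep F₂ φ →
      PreFrobenioid.IsPreStep F₁ (Ψ.inverse.map φ))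
    {N₁ : C₁} (hN₁ : ¬ PreFrobenioid.IsGroupLikeObj F₁ N₁) {A B : C₁} {φ : A ⟶ B}
    (hφ : PreFrobenioid.IsBaseIso F₁ φ) : PreFrobenioid.IsBaseIso F₂ (Ψ.functor.map φ) := by
  obtain ⟨X, β, α, hfac, hβ, hα⟩ :=
    (PreFrobenioid.isBaseIso_iff_exists_frobeniusType_preStep F₁ hF₁ φ).1 hφ
  rw [← hfac, Functor.map_comp]
  exact PreFrobenioid.IsBaseIso.comp F₂
    (isFrobeniusType_map hF₁ hF₂ hi₁ hi₂ hnd₂ Ψ hΨ hΨ' hN₁ _ hβ rfl).2 (hΨ hα).2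

/-- **Thm. 3.4 (iii): `Ψ` preserves pull-back morphisms** (Prop. 1.7 (ii): minimal-adjoint to the
base-isomorphisms, which `Ψ⁻¹` preserves). [cite: MochizukiFrdI2008, Thm. 3.4 (iii) p.64] -/
theorem isPullbackMorphism_map (hF₁ : PreFrobenioid.IsFrobenioid F₁)
    (hF₂ : PreFrobenioid.IsFrobenioid F₂) (hi₁ : ∀ A : C₁, PreFrobenioid.IsIsotropic F₁ A)
    (hi₂ : ∀ A : C₂, PreFrobenioid.IsIsotropic F₂ A) (hnd₁ : IsNonDilatingOn Φ₁) (Ψ : C₁ ≌ C₂)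
    (hΨ : ∀ ⦃A B : C₁⦄ ⦃φ : A ⟶ B⦄, PreFrobenioid.IsPreStep F₁ φ →
      PreFrobenioid.IsPreStep F₂ (Ψ.functor.map φ))
    (hΨ' : ∀ ⦃A B : C₂⦄ ⦃φ : A ⟶ B⦄, PreFrobenioid.IsPreStep F₂ φ →
      PreFrobenioid.IsPreStep F₁ (Ψ.inverse.map φ))
    {N₂ : C₂} (hN₂ : ¬ PreFrobenioid.IsGroupLikeObj F₂ N₂)
    {A B : C₁} {φ : A ⟶ B} (hφ : PreFrobenioid.IsPullbackMorphism F₁ φ) :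
    PreFrobenioid.IsPullbackMorphism F₂ (Ψ.functor.map φ) := by
  rw [PreFrobenioid.isPullbackMorphism_iff_isMinimalAdjoint F₂ hF₂]
  refine ((PreFrobenioid.isPullbackMorphism_iff_isMinimalAdjoint F₁ hF₁ φ).1 hφ).map_equivalence Ψ
    (S₂ := PreFrobenioid.baseIsomorphisms F₂) (fun X Y β hβ => ?_) (fun X X' Y i β hi hβ => ?_)
  · exact isBaseIso_map hF₂ hF₁ hi₂ hi₁ hnd₁ Ψ.symm hΨ' hΨ hN₂ hβ
  · haveI := hi
    exact PreFrobenioid.IsBaseIso.comp F₁ (PreFrobenioid.isBaseIso_of_isIso F₁ i) hβ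

/-- **Thm. 3.4 (iii): `Ψ` preserves isometries** (factor `φ = α ∘ β ∘ γ`, Def. 1.3 (iv)(a): the
pre-step `β` is isometric, hence invertible in isotropic type; `Ψγ` is of Frobenius type and `Ψα` a
pull-back morphism). [cite: MochizukiFrdI2008, Thm. 3.4 (iii) p.64] -/
theorem isIsometry_map (hF₁ : PreFrobenioid.IsFrobenioid F₁) (hF₂ : PreFrobenioid.IsFrobenioid F₂)
    (hi₁ : ∀ A : C₁, PreFrobenioid.IsIsotropic F₁ A) (hi₂ : ∀ A : C₂, PreFrobenioid.IsIsotropic F₂ A)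
    (hnd₁ : IsNonDilatingOn Φ₁) (hnd₂ : IsNonDilatingOn Φ₂) (Ψ : C₁ ≌ C₂)
    (hΨ : ∀ ⦃A B : C₁⦄ ⦃φ : A ⟶ B⦄, PreFrobenioid.IsPreStep F₁ φ →
      PreFrobenioid.IsPreStep F₂ (Ψ.functor.map φ))
    (hΨ' : ∀ ⦃A B : C₂⦄ ⦃φ : A ⟶ B⦄, PreFrobenioid.IsPreStep F₂ φ →
      PreFrobenioid.IsPreStep F₁ (Ψ.inverse.map φ))
    {N₁ : C₁} (hN₁ : ¬ PreFrobenioid.IsGroupLikeObj F₁ N₁)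
    {N₂ : C₂} (hN₂ : ¬ PreFrobenioid.IsGroupLikeObj F₂ N₂) {A B : C₁} {φ : A ⟶ B}
    (hφ : PreFrobenioid.IsIsometry F₁ φ) : PreFrobenioid.IsIsometry F₂ (Ψ.functor.map φ) := by
  have hP₁ := hF₁.isPreFrobenioid
  have hP₂ := hF₂.isPreFrobenioid
  obtain ⟨X, Y, γ, β, α, hfac, hγ, hβ, hα⟩ := hF₁.iv_a_exists φ
  -- the middle pre-step is an isometry, hence an isomorphism
  have hβi : PreFrobenioid.IsIsometry F₁ β := by
    have h : PreFrobenioid.IsIsometry F₁ (γ ≫ β ≫ α) := by rw [hfac]; exact hφ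
    exact (PreFrobenioid.isIsometry_factors F₁ hP₁ (PreFrobenioid.isIsometry_factors F₁ hP₁ h).1).2
  haveI : IsIso β := hi₁ X β hβi hβ
  rw [← hfac, Functor.map_comp, Functor.map_comp]
  refine PreFrobenioid.IsIsometry.comp F₂
    (isFrobeniusType_map hF₁ hF₂ hi₁ hi₂ hnd₂ Ψ hΨ hΨ' hN₁ _ hγ rfl).1.2
    (PreFrobenioid.IsIsometry.comp F₂ (PreFrobenioid.isIsometry_of_isIso F₂ hP₂ _) ?_)
  exact (hF₂.iv_b _ (isPullbackMorphism_map hF₁ hF₂ hi₁ hi₂ hnd₁ Ψ hΨ hΨ' hN₂ hα)).1.2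

/-- **Thm. 3.4 (iii): `Ψ` preserves co-angular and LB-invertible morphisms** (every morphism of a
Frobenioid of isotropic type is co-angular). [cite: MochizukiFrdI2008, Thm. 3.4 (iii) p.64] -/
theorem isLBInvertible_map (hF₁ : PreFrobenioid.IsFrobenioid F₁)
    (hF₂ : PreFrobenioid.IsFrobenioid F₂) (hi₁ : ∀ A : C₁, PreFrobenioid.IsIsotropic F₁ A)
    (hi₂ : ∀ A : C₂, PreFrobenioid.IsIsotropic F₂ A) (hnd₁ : IsNonDilatingOn Φ₁)
    (hnd₂ : IsNonDilatingOn Φ₂) (Ψ : C₁ ≌ C₂)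
    (hΨ : ∀ ⦃A B : C₁⦄ ⦃φ : A ⟶ B⦄, PreFrobenioid.IsPreStep F₁ φ →
      PreFrobenioid.IsPreStep F₂ (Ψ.functor.map φ))
    (hΨ' : ∀ ⦃A B : C₂⦄ ⦃φ : A ⟶ B⦄, PreFrobenioid.IsPreStep F₂ φ →
      PreFrobenioid.IsPreStep F₁ (Ψ.inverse.map φ))
    {N₁ : C₁} (hN₁ : ¬ PreFrobenioid.IsGroupLikeObj F₁ N₁) {N₂ : C₂}
    (hN₂ : ¬ PreFrobenioid.IsGroupLikeObj F₂ N₂) {A B : C₁} {φ : A ⟶ B}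
    (hφ : PreFrobenioid.IsLBInvertible F₁ φ) : PreFrobenioid.IsLBInvertible F₂ (Ψ.functor.map φ) :=
  ⟨PreFrobenioid.isCoAngular_of_isIsotropic_codomains F₂ _ (fun Z _ => hi₂ Z),
    isIsometry_map hF₁ hF₂ hi₁ hi₂ hnd₁ hnd₂ Ψ hΨ hΨ' hN₁ hN₂ hφ.2⟩

/-- **Isotropic type: `Ψ` preserves the Frobenius degree of every morphism** (factor `φ = α ∘ β ∘ γ`,
Def. 1.3 (iv)(a): the pre-step and pull-back parts stay linear; (F3) on the Frobenius-type part).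
[cite: MochizukiFrdI2008, Thm. 3.4 (iii) p.64] -/
theorem degFr_map_of_isotropic (hF₁ : PreFrobenioid.IsFrobenioid F₁)
    (hF₂ : PreFrobenioid.IsFrobenioid F₂) (hi₁ : ∀ A : C₁, PreFrobenioid.IsIsotropic F₁ A)
    (hi₂ : ∀ A : C₂, PreFrobenioid.IsIsotropic F₂ A) (hnd₁ : IsNonDilatingOn Φ₁)
    (hnd₂ : IsNonDilatingOn Φ₂) (Ψ : C₁ ≌ C₂)
    (hΨ : ∀ ⦃A B : C₁⦄ ⦃φ : A ⟶ B⦄, PreFrobenioid.IsPreStep F₁ φ →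
      PreFrobenioid.IsPreStep F₂ (Ψ.functor.map φ))
    (hΨ' : ∀ ⦃A B : C₂⦄ ⦃φ : A ⟶ B⦄, PreFrobenioid.IsPreStep F₂ φ →
      PreFrobenioid.IsPreStep F₁ (Ψ.inverse.map φ))
    {N₁ : C₁} (hN₁ : ¬ PreFrobenioid.IsGroupLikeObj F₁ N₁) {N₂ : C₂}
    (hN₂ : ¬ PreFrobenioid.IsGroupLikeObj F₂ N₂) {A B : C₁} (φ : A ⟶ B) :
    PreFrobenioid.degFr F₂ (Ψ.functor.map φ) = PreFrobenioid.degFr F₁ φ := by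
  obtain ⟨X, Y, γ, β, α, hfac, hγ, hβ, hα⟩ := hF₁.iv_a_exists φ
  have hΨβ := hΨ hβ
  have hΨα := isPullbackMorphism_map hF₁ hF₂ hi₁ hi₂ hnd₁ Ψ hΨ hΨ' hN₂ hα
  apply PNat.eq
  rw [← hfac, Functor.map_comp, Functor.map_comp, PreFrobenioid.degFr_comp, PreFrobenioid.degFr_comp,
    PreFrobenioid.degFr_comp, PreFrobenioid.degFr_comp, show PreFrobenioid.degFr F₂ (Ψ.functor.map β) = 1
    from hΨβ.1, show PreFrobenioid.degFr F₂ (Ψ.functor.map α) = 1 from (hF₂.iv_b _ hΨα).2,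
    show PreFrobenioid.degFr F₁ β = 1 from hβ.1, show PreFrobenioid.degFr F₁ α = 1 from (hF₁.iv_b _ hα).2]
  simp only [mul_one]
  exact degFr_map_of_isFrobeniusType hF₁ hF₂ hi₁ hi₂ hnd₁ hnd₂ Ψ hΨ hΨ' hN₁ hN₂ _ hγ rfl

end Two

end OfPreSteps

end FrdI

end Literature.AlgebraicGeometry.Frobenioids
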